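import Summits.QuantumFields.YangMills.Theorems.BalabanLadderIRAfOnsetDoubleSums
import Summits.QuantumFields.YangMills.Theorems.BalabanLadderIRAfOnsetTails
import Summits.QuantumFields.YangMills.Theorems.BalabanLadderIRAfOnsetHalfSpace

/-!
# Crux `IR` (stmt-QuantumFields-19354), line `af-pincer`, stub `stub_afOnsetUc : AFToOnsetUKPc` (X-side):
# «asymptotic freedom below a scale» from COVARIANCE-LEVEL hypotheses

Seat ym-19354-afpincer-s2 (generation 2); slot `af-pincer-Uc` (owner registry R89, sha16 d9d9d710e4ae01bd; the stub
`stub_afOnsetUc : AfPincerUc.AFToOnsetUKPc` VERBATIM, tree constant `Theorems/IR/AfPincerUcFormat`).  Generation 0 boxed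
the stub (`Theorems/IR/AfPincerUcX`, `…XPoly`, `…AfOnset{LargeUnit,PlaquetteMoments,Covariance,LatticeAF}`): it is
decided on every tail where the onset `b⋆ = mixOnsetUc` is bounded, where `δ ≥ 1`, or where `b⋆⁴ log β = O(β)`; its only
open content is the super-polynomial onset regime, «mixing follows interaction».  The crux-plan desk (cplan g10,
`Sketch-g10-sharp.lean` §2) isolated the S2 done-when WITHOUT onset or format:

  `AFBelowScaleAt G r ℓ`:  `∀ v (tsupport v ⊆ {y | 0 < y 0}) ∀ η > 0 ∃ T β₁ ∀ β ≥ β₁ ∀ s > 0, T ≤ s·ℓ(β) →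
                           ∃ᶠ L, |Q2 G r β L s (θv) v| ≤ η`

(the X-clause at `(G, r, n, ε, δ)` follows from it and the LEAD's «format at mesh `≤ B·ℓ(β)`», cplan's
`afToOnset_clause_of_scale`, re-proved in the sequel as `xClause_of_formatAtScale_of_afBelowScale`).

THIS FILE proves `AFBelowScaleAt G r ℓ` (its body, verbatim) from two COVARIANCE-LEVEL hypotheses on the torus
covariances `Cov_{β,L}(A_x, A_y)` of the action density (`A_x = dens G r x`, tori `2L+1`, pairs of `box L` at
`ℤ⁴`-sup-distance `≤ L`, where it is the torus distance):

* (AF)  the ASYMPTOTIC-FREEDOM WINDOW at scale `ℓ`: `∀ W > 0 ∃ T' > 0, β₀ : ∀ β ≥ β₀, ∀ᶠ L, ∀ x y,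
        T'·‖x − y‖ ≤ ℓ(β) → |Cov_{β,L}(A_x, A_y)| ≤ W (1 + ‖x − y‖)⁻⁸` — the dimensionless two-point function of the
        dimension-4 density is SMALL at lattice separations `≤ ℓ(β)/T'` (physically `≍ g_eff(ℓ/T')⁴ → 0` as `T' → ∞`
        when `ℓ ≍ ξ_lat`, by asymptotic freedom; at bounded separations it is `O(β⁻²)`, tree `…AfOnsetCovariance`);
* (ENV) the CROSSOVER ENVELOPE: `∃ W₀ β₀ : ∀ β ≥ β₀, ∀ᶠ L, ∀ x y, |Cov_{β,L}(A_x, A_y)| ≤ W₀ (1 + ‖x − y‖)⁻⁸` — the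
        same two-point function is BOUNDED at all separations (needed only beyond the window, where for
        `‖x−y‖ ≳ ℓ log ℓ` it is implied by exponential clustering at rate `κ/ℓ` — the E∘I output of the slot — and on
        `[ℓ/T', ℓ log ℓ]` it is the genuinely non-perturbative statement «the crossover two-point function of `tr F²` is
        finite in scale-invariant units»).

Main result (namespace `…Cruxes.IR.AfPincerUc`): **`afBelowScale_of_covarianceAF`** — (ENV) ∧ (AF at scale `ℓ`)
⇒ `AFBelowScaleAt G r ℓ` (body verbatim), via the termwise NEAR/FAR/WRAP split `abs_term_le_near_far_wrap`,
`abs_doubleSum_le_of_split` and the numerics `near_piece_le` / `far_piece_le` / `wrap_piece_le`.  The sequel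
`Theorems/IR/AfPincerUcXCovCompact` adds: the COMPACT-SUPPORT version (window ALONE suffices for compactly supported
`v`: the envelope is consumed only by Schwartz tails), cplan's contract lemma re-proved, the X-clause at
`(G, r, n, ε, δ)` from the hypotheses at the onset scale `ℓ = b⋆ = mixOnsetUc` (generation 0's «what is missing»), and
`AFToOnsetUKPc` BY NAME from the hypotheses at every parameter.

Mechanism: `|Q2| ≤ Σ_{x,y ∈ box L} |θv(s x)| |v(s y)| |Cov|`; at units `s ≥ s₀(η)` the large-unit lemma
(`AfOnset.exists_unit_forall_abs_Q2_thetaTest_le`); at `s < s₀` split the pairs into NEAR (`s‖x−y‖ ≤ R`: inside the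
window once `T = R T'`, weight `Σ |θv||v| (1+‖x−y‖)⁻⁸ ≤ J` UNIFORMLY in `s` — `AfOnset.doubleSum_kernel8_le`, the
cancellation of the `s⁻⁸` pairs against the cubic vanishing of `v, θv` at the time-zero plane), FAR (`s‖x−y‖ > R`,
`‖x−y‖ ≤ L`: envelope, weight `O(1/R)` — `doubleSum_kernel8_far_le`) and WRAP (`‖x−y‖ > L`: `|Cov| ≤ 2C²`, weight `→ 0`
as `L → ∞` — `doubleSum_wrap_le`); choose `R(η)`, then `W(η)`, then `T = R·T'(W)`.

HONEST FRAMING.  A kernel REDUCTION of the X-stub's done-when to two named covariance statements, both OPEN research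
statements about 4-d non-abelian lattice gauge theory at weak coupling (presearch: nothing in print beyond finite gauge
groups, AdhikariCao2022); the stub `stub_afOnsetUc` is NOT proved here; one open gap-crux of a CONDITIONAL chain
(Track A 0/28 UV); not a gap claim, not Clay.
-/

set_option autoImplicit false

noncomputable section

open Filter Topology Finset MeasureTheory
open scoped BigOperators SchwartzMap
open Literature.MathematicalPhysics.QuantumFieldTheory hiding ZdEdge
open Literature.MathematicalPhysics.QuantumLattice
open Literature.Probability.LatticeModels (Site box mem_box)
open Summit.QuantumFields.YangMills.Cruxes.OSLegsFromFemtoAndGap.DlrCollarTransfer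
open Summit.QuantumFields.YangMills.Theorems.OSLegsFromFemtoAndGap (mul_norm_le_norm_smul_siteToE)
open Summit.QuantumFields.YangMills.Theorems.InfiniteVolume (exists_abs_dens_le_uniform abs_torusCov_dens_le)
open Summit.QuantumFields.YangMills.Cruxes.IR.AfOnset

namespace Summit.QuantumFields.YangMills.Cruxes.IR.AfPincerUc

variable {G : Type} [Group G] [TopologicalSpace G] [IsTopologicalGroup G] [CompactSpace G]
  [MeasurableSpace G] [BorelSpace G]

/-! ## §1 `AFBelowScaleAt` from the asymptotic-freedom window and the crossover envelope -/
section Main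

/-- **Termwise splitting of `|F(s x) G(s y) Cov|` into NEAR / FAR / WRAP pieces.**  If the covariance of the pair
obeys the window bound `W (1+‖x−y‖)⁻⁸` when `‖x−y‖ ≤ L`, `s‖x−y‖ ≤ R`, the envelope `W₀ (1+‖x−y‖)⁻⁸` when `‖x−y‖ ≤ L`,
and `|Cov| ≤ C₀` (`W, W₀, C₀ ≥ 0`), then
`|F G Cov| ≤ W·|F||G|(1+‖x−y‖)⁻⁸ + W₀·𝟙[R < s‖x−y‖]|F||G|(1+‖x−y‖)⁻⁸ + C₀·𝟙[L < ‖x−y‖]|F||G|`. [folklore] -/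
theorem abs_term_le_near_far_wrap {F G : EuclideanSpace ℝ (Fin 4) → ℝ} {c s R W W₀ C₀ : ℝ} {L : ℕ}
    (hW : 0 ≤ W) (hW₀ : 0 ≤ W₀) (hC₀ : 0 ≤ C₀) (x y : Site 4) (hcov : |c| ≤ C₀)
    (henv : ‖x - y‖ ≤ (L : ℝ) → |c| ≤ W₀ / (1 + ‖x - y‖) ^ 8)
    (haf : ‖x - y‖ ≤ (L : ℝ) → s * ‖x - y‖ ≤ R → |c| ≤ W / (1 + ‖x - y‖) ^ 8) :
    |F (s • siteToE x) * G (s • siteToE y) * c| ≤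
      W * (|F (s • siteToE x)| * |G (s • siteToE y)| * ((1 + ‖x - y‖) ^ 8)⁻¹) +
        W₀ * (if R < s * ‖x - y‖ then |F (s • siteToE x)| * |G (s • siteToE y)| * ((1 + ‖x - y‖) ^ 8)⁻¹ else 0) +
        C₀ * (if (L : ℝ) < ‖x - y‖ then |F (s • siteToE x)| * |G (s • siteToE y)| else 0) := by
  rw [abs_mul, abs_mul]
  have hFG : 0 ≤ |F (s • siteToE x)| * |G (s • siteToE y)| := by positivity
  have hk : 0 ≤ ((1 + ‖x - y‖) ^ 8)⁻¹ := by positivity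
  have h0 : 0 ≤ W * (|F (s • siteToE x)| * |G (s • siteToE y)| * ((1 + ‖x - y‖) ^ 8)⁻¹) := by positivity
  have h1 : 0 ≤ W₀ * (if R < s * ‖x - y‖ then |F (s • siteToE x)| * |G (s • siteToE y)| *
      ((1 + ‖x - y‖) ^ 8)⁻¹ else 0) := by
    split_ifs <;> positivity
  have h2 : 0 ≤ C₀ * (if (L : ℝ) < ‖x - y‖ then |F (s • siteToE x)| * |G (s • siteToE y)| else 0) := by
    split_ifs <;> positivity
  by_cases hL : ‖x - y‖ ≤ (L : ℝ)
  · by_cases hR : s * ‖x - y‖ ≤ R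
    · -- NEAR: the window bound
      calc |F (s • siteToE x)| * |G (s • siteToE y)| * |c|
          ≤ |F (s • siteToE x)| * |G (s • siteToE y)| * (W / (1 + ‖x - y‖) ^ 8) :=
            mul_le_mul_of_nonneg_left (haf hL hR) hFG
        _ = W * (|F (s • siteToE x)| * |G (s • siteToE y)| * ((1 + ‖x - y‖) ^ 8)⁻¹) := by ring
        _ ≤ _ := by linarith
    · -- FAR: the envelope
      rw [not_le] at hR
      rw [if_pos hR] at h1 ⊢
      calc |F (s • siteToE x)| * |G (s • siteToE y)| * |c|
          ≤ |F (s • siteToE x)| * |G (s • siteToE y)| * (W₀ / (1 + ‖x - y‖) ^ 8) :=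
            mul_le_mul_of_nonneg_left (henv hL) hFG
        _ = W₀ * (|F (s • siteToE x)| * |G (s • siteToE y)| * ((1 + ‖x - y‖) ^ 8)⁻¹) := by ring
        _ ≤ _ := by linarith
  · -- WRAP: the uniform bound
    rw [not_le] at hL
    rw [if_pos hL] at h2 ⊢
    calc |F (s • siteToE x)| * |G (s • siteToE y)| * |c|
        ≤ |F (s • siteToE x)| * |G (s • siteToE y)| * C₀ := mul_le_mul_of_nonneg_left hcov hFG
      _ = C₀ * (|F (s • siteToE x)| * |G (s • siteToE y)|) := by ring
      _ ≤ _ := by linarith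

/-- **The split double sum.**  Summing `abs_term_le_near_far_wrap` over `X × Y`:
`|Σ_{x,y} F(s x) G(s y) Cov(x,y)| ≤ W·Σ|F||G|(1+‖x−y‖)⁻⁸ + W₀·Σ_{far}|F||G|(1+‖x−y‖)⁻⁸ + C₀·Σ_{wrap}|F||G|`. [folklore] -/
theorem abs_doubleSum_le_of_split {F G : EuclideanSpace ℝ (Fin 4) → ℝ} (cov : Site 4 → Site 4 → ℝ)
    {s R W W₀ C₀ : ℝ} {L : ℕ} (hW : 0 ≤ W) (hW₀ : 0 ≤ W₀) (hC₀ : 0 ≤ C₀) (X Y : Finset (Site 4))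
    (hcov : ∀ x ∈ X, ∀ y ∈ Y, |cov x y| ≤ C₀)
    (henv : ∀ x ∈ X, ∀ y ∈ Y, ‖x - y‖ ≤ (L : ℝ) → |cov x y| ≤ W₀ / (1 + ‖x - y‖) ^ 8)
    (haf : ∀ x ∈ X, ∀ y ∈ Y, ‖x - y‖ ≤ (L : ℝ) → s * ‖x - y‖ ≤ R → |cov x y| ≤ W / (1 + ‖x - y‖) ^ 8) :
    |∑ x ∈ X, ∑ y ∈ Y, F (s • siteToE x) * G (s • siteToE y) * cov x y| ≤
      W * ∑ x ∈ X, ∑ y ∈ Y, |F (s • siteToE x)| * |G (s • siteToE y)| * ((1 + ‖x - y‖) ^ 8)⁻¹ +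
        W₀ * ∑ x ∈ X, ∑ y ∈ Y,
          (if R < s * ‖x - y‖ then |F (s • siteToE x)| * |G (s • siteToE y)| * ((1 + ‖x - y‖) ^ 8)⁻¹ else 0) +
        C₀ * ∑ x ∈ X, ∑ y ∈ Y, (if (L : ℝ) < ‖x - y‖ then |F (s • siteToE x)| * |G (s • siteToE y)| else 0) := by
  calc |∑ x ∈ X, ∑ y ∈ Y, F (s • siteToE x) * G (s • siteToE y) * cov x y|
      ≤ ∑ x ∈ X, |∑ y ∈ Y, F (s • siteToE x) * G (s • siteToE y) * cov x y| := Finset.abs_sum_le_sum_abs _ _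
    _ ≤ ∑ x ∈ X, ∑ y ∈ Y, |F (s • siteToE x) * G (s • siteToE y) * cov x y| :=
        Finset.sum_le_sum fun x _ => Finset.abs_sum_le_sum_abs _ _
    _ ≤ ∑ x ∈ X, ∑ y ∈ Y,
          (W * (|F (s • siteToE x)| * |G (s • siteToE y)| * ((1 + ‖x - y‖) ^ 8)⁻¹) +
            W₀ * (if R < s * ‖x - y‖ then
              |F (s • siteToE x)| * |G (s • siteToE y)| * ((1 + ‖x - y‖) ^ 8)⁻¹ else 0) +
            C₀ * (if (L : ℝ) < ‖x - y‖ then |F (s • siteToE x)| * |G (s • siteToE y)| else 0)) :=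
        Finset.sum_le_sum fun x hx => Finset.sum_le_sum fun y hy =>
          abs_term_le_near_far_wrap hW hW₀ hC₀ x y (hcov x hx y hy) (henv x hx y hy) (haf x hx y hy)
    _ = _ := by simp only [Finset.sum_add_distrib, Finset.mul_sum]

/-- Numerics of the NEAR piece: `W·J ≤ η/4` for `W = η / (4 (J+1))`. [folklore] -/
theorem near_piece_le {η J : ℝ} (hη : 0 < η) (hJ : 0 ≤ J) : η / (4 * (J + 1)) * J ≤ η / 4 := by
  rw [div_mul_eq_mul_div, div_le_div_iff₀ (by positivity) (by norm_num)]
  nlinarith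

/-- Numerics of the FAR piece: `W₀·(J/R) ≤ η/4` for `R = 4 W₀ J/η + 1`. [folklore] -/
theorem far_piece_le {η J W₀ : ℝ} (hη : 0 < η) (hJ : 0 ≤ J) (hW₀ : 0 ≤ W₀) :
    W₀ * (J / (4 * W₀ * J / η + 1)) ≤ η / 4 := by
  have hR : 0 < 4 * W₀ * J / η + 1 := by positivity
  have hηR : η * (4 * W₀ * J / η + 1) = 4 * (W₀ * J) + η := by field_simp
  rw [mul_div_assoc', div_le_iff₀ hR]
  nlinarith

/-- Numerics of the WRAP piece: `C₀ · 2C²Z²/(D m) ≤ η/4` once `D ≥ 8 C₀ C² Z²/(η m) + 1`. [folklore] -/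
theorem wrap_piece_le {η C₀ C Z m D : ℝ} (hη : 0 < η) (hm : 0 < m) (hD0 : 0 < D)
    (hD : 8 * C₀ * C ^ 2 * Z ^ 2 / (η * m) + 1 ≤ D) :
    C₀ * (2 * C ^ 2 * Z ^ 2 / (D * m)) ≤ η / 4 := by
  have hkey : 8 * C₀ * C ^ 2 * Z ^ 2 ≤ η * (D * m) := by
    have h1 : 8 * C₀ * C ^ 2 * Z ^ 2 / (η * m) ≤ D := by linarith
    rw [div_le_iff₀ (by positivity)] at h1
    linarith
  rw [← mul_div_assoc, div_le_iff₀ (by positivity)]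
  linarith

/-- In the regime `s < s₀` of the main estimate: `s / min(s,1) ≤ max(s₀,1)`. [folklore] -/
theorem div_min_le_max {s s₀ : ℝ} (hs : 0 < s) (hss : s ≤ s₀) : s / min s 1 ≤ max s₀ 1 := by
  by_cases h1 : s ≤ 1
  · rw [min_eq_left h1, div_self hs.ne']; exact le_max_right _ _
  · rw [not_le] at h1
    rw [min_eq_right h1.le, div_one]; exact hss.trans (le_max_left _ _)

/-- **`AFBelowScaleAt G r ℓ` from COVARIANCE-LEVEL hypotheses** (crossover ENVELOPE ∧ asymptotic-freedom WINDOW at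
scale `ℓ`, both on pairs of the box at sup-distance `≤ L`, eventually in the torus):  for every real test function `v`
supported at positive times and every `η > 0` there are `T, β₁` with
`β ≥ β₁, s > 0, T ≤ s·ℓ(β) ⟹ ∃ᶠ L, |Q2 G r β L s (θv) v| ≤ η` — the body of cplan g10's S2 done-when `AFBelowScaleAt`
VERBATIM.  Witness: `T = R(η)·T'(W(η))` with `R = 4 W₀ J/η + 1`, `W = η/(4(J+1))`, `J = 64 C² Z₃² max(s₀,1)³`
(`s₀ = s₀(η)` the large unit, `C` the cubic-vanishing constant of `v, θv`). [folklore reduction; the hypotheses are OPEN] -/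
theorem afBelowScale_of_covarianceAF (r : LatticeRep G) (ℓ : ℝ → ℝ)
    (henv : ∃ W₀ β₀ : ℝ, ∀ β : ℝ, β₀ ≤ β → ∀ᶠ L : ℕ in atTop, ∀ x ∈ box 4 L, ∀ y ∈ box 4 L,
      ‖x - y‖ ≤ (L : ℝ) →
        |torusE G r β L (fun U => dens G r x U * dens G r y U) -
            torusE G r β L (dens G r x) * torusE G r β L (dens G r y)| ≤ W₀ / (1 + ‖x - y‖) ^ 8)
    (haf : ∀ W : ℝ, 0 < W → ∃ T' β₀ : ℝ, 0 < T' ∧ ∀ β : ℝ, β₀ ≤ β → ∀ᶠ L : ℕ in atTop,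
      ∀ x ∈ box 4 L, ∀ y ∈ box 4 L, ‖x - y‖ ≤ (L : ℝ) → T' * ‖x - y‖ ≤ ℓ β →
        |torusE G r β L (fun U => dens G r x U * dens G r y U) -
            torusE G r β L (dens G r x) * torusE G r β L (dens G r y)| ≤ W / (1 + ‖x - y‖) ^ 8)
    (v : 𝓢(EuclideanSpace ℝ (Fin 4), ℝ)) (hv : tsupport v ⊆ {y : EuclideanSpace ℝ (Fin 4) | 0 < y 0})
    {η : ℝ} (hη : 0 < η) :
    ∃ T β₁ : ℝ, ∀ β : ℝ, β₁ ≤ β → ∀ s : ℝ, 0 < s → T ≤ s * ℓ β →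
      ∃ᶠ (L : ℕ) in atTop, |Q2 G r β L s (thetaTest 4 v) v| ≤ η := by
  classical
  -- the cubic-vanishing constants of `θv` and `v`
  obtain ⟨Cθ, hCθ0, hCθ⟩ := exists_abs_thetaTest_le_cube_div v hv
  obtain ⟨Cv, hCv0, hCv⟩ := exists_abs_le_cube_div_of_tsupport v hv
  have hC0 : 0 ≤ max Cθ Cv := hCθ0.trans (le_max_left _ _)
  have hF : ∀ u : EuclideanSpace ℝ (Fin 4), |thetaTest 4 v u| ≤ max Cθ Cv * |u 0| ^ 3 / (1 + ‖u‖) ^ 10 :=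
    fun u => (hCθ u).trans (by gcongr; exact le_max_left _ _)
  have hG : ∀ u : EuclideanSpace ℝ (Fin 4), |v u| ≤ max Cθ Cv * |u 0| ^ 3 / (1 + ‖u‖) ^ 10 :=
    fun u => (hCv u).trans (by gcongr; exact le_max_right _ _)
  have hF0 : ∀ u : EuclideanSpace ℝ (Fin 4), 0 ≤ u 0 → thetaTest 4 v u = 0 :=
    thetaTest_apply_eq_zero_of_tsupport_subset v hv
  have hG0 : ∀ u : EuclideanSpace ℝ (Fin 4), u 0 ≤ 0 → v u = 0 := apply_eq_zero_of_tsupport_subset v hv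
  -- large units, uniform covariance bound
  obtain ⟨s₀, hs₀1, hlarge⟩ := exists_unit_forall_abs_Q2_thetaTest_le r v hv hη
  obtain ⟨Cd, hCd0, hCd⟩ := exists_abs_dens_le_uniform (G := G) r
  -- the constants `J`, `R`, `W`
  set C : ℝ := max Cθ Cv with hC
  set Z₃ : ℝ := 3 ^ 3 * ∑' k : ℕ, (((k : ℝ) + 1) ^ 2)⁻¹ with hZ₃
  have hZ₃0 : 0 ≤ Z₃ := riemann_const_nonneg 3
  set J : ℝ := 64 * C ^ 2 * Z₃ ^ 2 * (max s₀ 1) ^ 3 with hJ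
  have hJ0 : 0 ≤ J := by positivity
  obtain ⟨W₀, βe, henv'⟩ := henv
  have hW₀'0 : 0 ≤ max W₀ 0 := le_max_right _ _
  set R : ℝ := 4 * max W₀ 0 * J / η + 1 with hR
  have hR0 : 0 < R := by positivity
  obtain ⟨T', βa, hT'0, haf'⟩ := haf (η / (4 * (J + 1))) (by positivity)
  refine ⟨R * T', max βe βa, fun β hβ s hs hT => ?_⟩
  have hβe : βe ≤ β := le_trans (le_max_left _ _) hβ
  have hβa : βa ≤ β := le_trans (le_max_right _ _) hβ
  by_cases hs₀ : s₀ ≤ s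
  · exact Filter.Eventually.frequently (Filter.Eventually.of_forall fun L => hlarge β L s hs₀)
  rw [not_le] at hs₀
  have hmin : 0 < min s 1 := lt_min hs one_pos
  have hsm : s / min s 1 ≤ max s₀ 1 := div_min_le_max hs hs₀.le
  have hsm0 : 0 ≤ s / min s 1 := by positivity
  -- near pairs lie in the window: `s‖x - y‖ ≤ R ⟹ T'‖x - y‖ ≤ ℓ β`
  have hwin : ∀ x y : Site 4, s * ‖x - y‖ ≤ R → T' * ‖x - y‖ ≤ ℓ β := by
    intro x y hxy
    have h1 : s * (T' * ‖x - y‖) ≤ s * ℓ β := by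
      calc s * (T' * ‖x - y‖) = T' * (s * ‖x - y‖) := by ring
        _ ≤ T' * R := mul_le_mul_of_nonneg_left hxy hT'0.le
        _ = R * T' := by ring
        _ ≤ s * ℓ β := hT
    exact le_of_mul_le_mul_left h1 hs
  -- the wrap threshold in `L`
  set Z₄ : ℝ := 3 ^ 4 * ∑' k : ℕ, (((k : ℝ) + 1) ^ 2)⁻¹ with hZ₄
  set A : ℝ := 8 * (2 * Cd ^ 2) * C ^ 2 * Z₄ ^ 2 / (η * (min s 1) ^ 8) + 1 with hA
  have hA0 : 0 < A := by positivity
  have hwrap_ev : ∀ᶠ L : ℕ in atTop, A ≤ 1 + s * ((L : ℝ) / 2) := by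
    refine (Filter.eventually_ge_atTop ⌈2 * A / s⌉₊).mono fun L hL => ?_
    have h1 : 2 * A / s ≤ (L : ℝ) := (Nat.le_ceil _).trans (by exact_mod_cast hL)
    rw [div_le_iff₀ hs] at h1
    linarith
  refine (((henv' β hβe).and ((haf' β hβa).and hwrap_ev)).mono fun L hL => ?_).frequently
  obtain ⟨hE, hA', hWr⟩ := hL
  -- the three partial sums
  have hnear : ∑ x ∈ box 4 L, ∑ y ∈ box 4 L,
      |thetaTest 4 v (s • siteToE x)| * |v (s • siteToE y)| * ((1 + ‖x - y‖) ^ 8)⁻¹ ≤ J := by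
    refine (doubleSum_kernel8_le hC0 hF hF0 hG hG0 hs (box 4 L) (box 4 L)).trans ?_
    rw [hJ]
    gcongr
  have hfar : ∑ x ∈ box 4 L, ∑ y ∈ box 4 L,
      (if R < s * ‖x - y‖ then |thetaTest 4 v (s • siteToE x)| * |v (s • siteToE y)| * ((1 + ‖x - y‖) ^ 8)⁻¹
        else 0) ≤ J / R := by
    refine (doubleSum_kernel8_far_le hC0 hF hF0 hG hG0 hs hR0 (box 4 L) (box 4 L)).trans ?_
    have hre : 64 * (max Cθ Cv) ^ 2 * (3 ^ 3 * ∑' k : ℕ, (((k : ℝ) + 1) ^ 2)⁻¹) ^ 2 * s ^ 3 /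
        ((min s 1) ^ 3 * R) = 64 * C ^ 2 * Z₃ ^ 2 * (s / min s 1) ^ 3 / R := by
      rw [hZ₃, hC]; field_simp
    rw [hre, hJ]
    gcongr
  have hwrap : ∑ x ∈ box 4 L, ∑ y ∈ box 4 L,
      (if (L : ℝ) < ‖x - y‖ then |thetaTest 4 v (s • siteToE x)| * |v (s • siteToE y)| else 0) ≤
        2 * C ^ 2 * Z₄ ^ 2 / ((1 + s * ((L : ℝ) / 2)) * (min s 1) ^ 8) :=
    doubleSum_wrap_le hC0 hF hG hs L
  -- the split
  have hsplit := abs_doubleSum_le_of_split (F := ⇑(thetaTest 4 v)) (G := ⇑v)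
    (fun x y => torusE G r β L (fun U => dens G r x U * dens G r y U) -
      torusE G r β L (dens G r x) * torusE G r β L (dens G r y))
    (s := s) (R := R) (L := L) (le_of_lt (show (0 : ℝ) < η / (4 * (J + 1)) by positivity)) hW₀'0
    (show (0 : ℝ) ≤ 2 * Cd ^ 2 by positivity) (box 4 L) (box 4 L)
    (fun x _ y _ => abs_torusCov_dens_le r hCd0 hCd β L x y)
    (fun x hx y hy hL' => (hE x hx y hy hL').trans
      (div_le_div_of_nonneg_right (le_max_left _ _) (by positivity)))
    (fun x hx y hy hL' hR' => hA' x hx y hy hL' (hwin x y hR'))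
  have hQ : Q2 G r β L s (thetaTest 4 v) v = ∑ x ∈ box 4 L, ∑ y ∈ box 4 L,
      thetaTest 4 v (s • siteToE x) * v (s • siteToE y) *
        (torusE G r β L (fun U => dens G r x U * dens G r y U) -
          torusE G r β L (dens G r x) * torusE G r β L (dens G r y)) := rfl
  rw [hQ]
  refine hsplit.trans ?_
  calc η / (4 * (J + 1)) * ∑ x ∈ box 4 L, ∑ y ∈ box 4 L,
            |thetaTest 4 v (s • siteToE x)| * |v (s • siteToE y)| * ((1 + ‖x - y‖) ^ 8)⁻¹ +
          max W₀ 0 * ∑ x ∈ box 4 L, ∑ y ∈ box 4 L, (if R < s * ‖x - y‖ then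
              |thetaTest 4 v (s • siteToE x)| * |v (s • siteToE y)| * ((1 + ‖x - y‖) ^ 8)⁻¹ else 0) +
          2 * Cd ^ 2 * ∑ x ∈ box 4 L, ∑ y ∈ box 4 L,
            (if (L : ℝ) < ‖x - y‖ then |thetaTest 4 v (s • siteToE x)| * |v (s • siteToE y)| else 0)
      ≤ η / (4 * (J + 1)) * J + max W₀ 0 * (J / R) +
          2 * Cd ^ 2 * (2 * C ^ 2 * Z₄ ^ 2 / ((1 + s * ((L : ℝ) / 2)) * (min s 1) ^ 8)) := by
        gcongr
    _ ≤ η / 4 + η / 4 + η / 4 :=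
        add_le_add_three (near_piece_le hη hJ0) (far_piece_le hη hJ0 hW₀'0)
          (wrap_piece_le hη (pow_pos hmin 8) (by positivity) hWr)
    _ ≤ η := by linarith

end Main

end Summit.QuantumFields.YangMills.Cruxes.IR.AfPincerUc

end
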